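import Summits.KontsevichZagierPeriods.KontsevichZagierPeriods.Theorems.LinRedNormalFormArrangementNormalFormStubRebaseSimpleZeroNestedDiffE1Janus

/-!
# Stub `stub_rebaseSimpleZeroTwo`, part `rebaseSimpleZero_HDiff1_of_HPar1` (crux
`ArrangementNormalForm`, line `janus-bands`) — brick `NestedDiffE1Cell`

**One grid cell of the box-Janus reduction of `HDiff₁` to `HPar1`.** A datum of `HDiff₁`
(`RebaseE1.IsDN`: clean nest `A(y) < tᵢ < tⱼ < B(y)` over `{l < y < u}`, inner letter `cᵢ`
constant, outer letter `cⱼ` of slope `λ ≠ 0`) over a SHORT interval away from the base pole on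
which the band is THICK (`max A + G ≤ min B`, `(|A'| + |B'| + |λ| + 1)(u − l) ≤ G/8`) is good for
`GG 0 2 2` as soon as `HPar1` holds (`RebaseE1.IsDN.good_thin`), by three dissections with
margins `≥ G/8` from every pole:
1. cut `tⱼ` at the constant section `T₁ = (max A + min B)/2` (rule 1a): the upper nest
   `T₁ < tᵢ < tⱼ < B` has a constant lower bound (`HPar1`), the middle piece is a product;
2. cut the lower nest `A < tᵢ < tⱼ < T₁` at the letter-parallel section `S₁` of slope `λ` through
   `(l, (A(l) + T₁)/2)`: the lower nest `A < tᵢ < tⱼ < S₁` has a letter-parallel top (`HPar1`);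
3. the remaining nest `S₁ < tᵢ < tⱼ < T₁` is the signed sub-section Janus at the constant
   `T = min S₁`: `[T<tᵢ<tⱼ<T₁] − [T<tᵢ<tⱼ<S₁] − product`, both nests with constant lower bound
   (`HPar1`), the literal integrand being BOUNDED on `{T < tᵢ < tⱼ < T₁}` (the letters lie weakly
   outside the band, `IsDN.inner_side/outer_side`, hence at distance `≥ G/8` from this box).

References: M. Kontsevich, D. Zagier, *Periods* (2001), §1.2, rules (1a), (2).
-/

noncomputable section

open Set MeasureTheory MvPolynomial
open Literature.NumberTheory.Transcendental Literature.ModelTheory.ExponentialFields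

namespace Summit.KontsevichZagierPeriods.ArrangementNormalForm.JanusBands

namespace RebaseE1

open SeparatePos RebasePos RebaseZero RebaseNest RebaseDiff

variable {i j : Fin 2} {s : KZ.IntegralRep (0 + 1 + 2)} {l u : ℚ} {A B : Cf} {T : BData}
  {p : MvPolynomial (Fin 0) ℚ} {a : Fin 2 → Option Cf} {ci cj : Cf}

/-- Rational evaluation of an atom at a rational point. [folklore] -/
def evq (c : Cf) (q : ℚ) : ℚ := c.1 (Fin.last 0) * q + c.2

/-- `ev` at a rational point is `evq`. -/
@[simp] theorem ev_ratCast (c : Cf) (q : ℚ) : ev c (q : ℝ) = (evq c q : ℝ) := by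
  rw [ev, evq]; push_cast; ring

/-- A constant section. -/
theorem ev_mk_zero (c : ℚ) (y : ℝ) : ev (RebaseZero.mk 0 c) y = c := by
  rw [ev_mk, Rat.cast_zero, zero_mul, zero_add]

/-- Rational bookkeeping of the thin cell: the mesh inequalities. [folklore] -/
theorem thin_arith {α β lam hh G : ℚ} (hh0 : 0 ≤ hh) (hthin : (|α| + |β| + |lam| + 1) * hh ≤ G / 8) :
    |α| * hh + |lam| * hh ≤ G / 8 ∧ -(|lam| * hh) ≤ min 0 (lam * hh) ∧ min 0 (lam * hh) ≤ 0 := by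
  have h1 : 0 ≤ |β| * hh := by positivity
  have e : (|α| + |β| + |lam| + 1) * hh = |α| * hh + |β| * hh + |lam| * hh + hh := by ring
  rw [e] at hthin
  have h2 : |lam * hh| = |lam| * hh := by rw [abs_mul, abs_of_nonneg hh0]
  have h3 := neg_abs_le (lam * hh)
  have h4 := abs_nonneg (lam * hh)
  refine ⟨by linarith, ?_, min_le_left _ _⟩
  rw [← h2]
  exact le_min (by linarith) h3

/-- **One grid cell.** A datum of `HDiff₁` over a short interval away from the base pole on which
the band is thick is good for `GG 0 2 2`, given `HPar1`. [Kontsevich–Zagier 2001, §1.2] -/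
theorem IsDN.good_thin (h : IsDN s l u A B T p a i j) (hL : LData T a i j ci cj) (hP : HParS T p a i j ci cj)
    (hK : Kc T p ≠ 0) (G : ℚ) (hG : 0 < G) (hgap : max (evq A l) (evq A u) + G ≤ min (evq B l) (evq B u))
    (hthin : (|A.1 (Fin.last 0)| + |B.1 (Fin.last 0)| + |cj.1 (Fin.last 0)| + 1) * (u - l) ≤ G / 8)
    (hr : T.ℓ₂.2 < l ∨ u < T.ℓ₂.2) : Good 2 (KZ.of s) := by
  have hij := h.ne
  have hadm : T.n₁ = 0 ∨ T.n₂ = 0 := Or.inl hL.n1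
  -- the constants
  set α : ℚ := A.1 (Fin.last 0) with hα
  set lam : ℚ := cj.1 (Fin.last 0) with hlam
  set hh : ℚ := u - l with hhh
  set Amax : ℚ := max (evq A l) (evq A u) with hAmax
  set Bmin : ℚ := min (evq B l) (evq B u) with hBmin
  set T₁ : ℚ := (Amax + Bmin) / 2 with hT₁
  set σ₀ : ℚ := (evq A l + T₁) / 2 with hσ₀
  set S₁ : Cf := RebaseZero.mk lam (σ₀ - lam * l) with hS₁
  set Tc : ℚ := σ₀ + min 0 (lam * hh) with hTc
  have hlam0 : lam ≠ 0 := hL.cj0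
  have hh0 : 0 < hh := by rw [hhh]; linarith [h.lu]
  -- rational bookkeeping
  have hAl : evq A l ≤ Amax := le_max_left _ _
  have q1 : Amax + G / 2 ≤ T₁ := by rw [hT₁]; linarith
  have q2 : T₁ + G / 2 ≤ Bmin := by rw [hT₁]; linarith
  have q3 : G / 4 ≤ σ₀ - evq A l := by rw [hσ₀]; linarith
  have q4 : G / 4 ≤ T₁ - σ₀ := by rw [hσ₀]; linarith
  obtain ⟨q5, q7, q8⟩ := thin_arith hh0.le hthin
  -- real bookkeeping
  have hluR : (l : ℝ) < u := by exact_mod_cast h.lu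
  have hh0R : (0 : ℝ) < hh := by exact_mod_cast hh0
  have hGR : (0 : ℝ) < G := by exact_mod_cast hG
  have q1R : (Amax : ℝ) + G / 2 ≤ T₁ := by exact_mod_cast q1
  have q2R : (T₁ : ℝ) + G / 2 ≤ Bmin := by exact_mod_cast q2
  have q3R : (G : ℝ) / 4 ≤ σ₀ - evq A l := by exact_mod_cast q3
  have q4R : (G : ℝ) / 4 ≤ T₁ - σ₀ := by exact_mod_cast q4
  have q5R : |(α : ℝ)| * hh + |(lam : ℝ)| * hh ≤ G / 8 := by
    have := q5; rw [← Rat.cast_abs, ← Rat.cast_abs]; exact_mod_cast this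
  have q7R : (σ₀ : ℝ) - |(lam : ℝ)| * hh ≤ Tc := by
    have : σ₀ - |lam| * hh ≤ Tc := by rw [hTc]; linarith
    rw [← Rat.cast_abs]; exact_mod_cast this
  have q8R : (Tc : ℝ) ≤ σ₀ := by
    have : Tc ≤ σ₀ := by rw [hTc]; linarith
    exact_mod_cast this
  have evS : ∀ y : ℝ, ev S₁ y = σ₀ + lam * (y - l) := fun y => by rw [hS₁, ev_mk]; push_cast; ring
  have evA : ∀ y : ℝ, (l : ℝ) < y → y < u → ev A y ≤ evq A l + |(α : ℝ)| * hh := fun y h1 h2 => by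
    have hyl : |y - l| ≤ hh := by rw [abs_of_pos (by linarith)]; push_cast [hhh]; linarith
    have := ev_sub_ev_le A (y := y) (y' := l) hyl
    rw [ev_ratCast] at this
    linarith
  have evAmax : ∀ y : ℝ, (l : ℝ) < y → y < u → ev A y ≤ Amax := fun y h1 h2 => by
    have := ev_le_max_ends A h.lu h1.le h2.le
    rw [ev_ratCast, ev_ratCast] at this
    rw [hAmax, Rat.cast_max]
    exact this
  have evBmin : ∀ y : ℝ, (l : ℝ) < y → y < u → (Bmin : ℝ) ≤ ev B y := fun y h1 h2 => by
    have := min_ends_le_ev B h.lu h1.le h2.le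
    rw [ev_ratCast, ev_ratCast] at this
    rw [hBmin, Rat.cast_min]
    exact this
  have hlamy : ∀ y : ℝ, (l : ℝ) < y → y < u →
      -(|(lam : ℝ)| * hh) ≤ (lam : ℝ) * (y - l) ∧ (lam : ℝ) * (y - l) ≤ |(lam : ℝ)| * hh := fun y h1 h2 => by
    have e : |(lam : ℝ) * (y - l)| ≤ |(lam : ℝ)| * hh := by
      rw [abs_mul, abs_of_pos (by linarith : (0 : ℝ) < y - l)]
      exact mul_le_mul_of_nonneg_left (by push_cast [hhh]; linarith) (abs_nonneg _)
    exact abs_le.1 e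
  -- the sections against the band
  have hTcS : ∀ y : ℝ, (l : ℝ) < y → y < u → ev (RebaseZero.mk 0 Tc) y < ev S₁ y := fun y h1 h2 => by
    rw [ev_mk_zero, evS, hTc]
    rcases lt_or_gt_of_ne hlam0 with hl0 | hl0
    · have hl0' : (lam : ℝ) < 0 := by exact_mod_cast hl0
      have hm : min 0 (lam * hh) = lam * hh := min_eq_right (by nlinarith)
      have key : (lam : ℝ) * hh < lam * (y - l) := mul_lt_mul_of_neg_left (by push_cast [hhh]; linarith) hl0'
      rw [hm]; push_cast; linarith
    · have hl0' : (0 : ℝ) < lam := by exact_mod_cast hl0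
      have hm : min 0 (lam * hh) = 0 := min_eq_left (by positivity)
      have key : (0 : ℝ) < lam * (y - l) := mul_pos hl0' (by linarith)
      rw [hm]; push_cast; linarith
  have hAS : ∀ y : ℝ, (l : ℝ) < y → y < u → ev A y < ev S₁ y := fun y h1 h2 => by
    rw [evS]
    have := evA y h1 h2
    have := (hlamy y h1 h2).1
    linarith
  have hST : ∀ y : ℝ, (l : ℝ) < y → y < u → ev S₁ y < ev (RebaseZero.mk 0 T₁) y := fun y h1 h2 => by
    rw [evS, ev_mk_zero]
    have := (hlamy y h1 h2).2
    have : (0 : ℝ) ≤ |(α : ℝ)| * hh := by positivity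
    linarith
  have hAT : ∀ y : ℝ, (l : ℝ) < y → y < u → ev A y < ev (RebaseZero.mk 0 T₁) y := fun y h1 h2 =>
    (hAS y h1 h2).trans (hST y h1 h2)
  have hTB : ∀ y : ℝ, (l : ℝ) < y → y < u → ev (RebaseZero.mk 0 T₁) y < ev B y := fun y h1 h2 => by
    rw [ev_mk_zero]
    have := evBmin y h1 h2
    linarith
  -- the letters against the box `{Tc < tᵢ < tⱼ < T₁}`
  have hbox_i : ∀ z : Fin (0 + 1 + 2) → ℝ, (l : ℝ) < yv z → yv z < u → (Tc : ℝ) < tv z i → tv z i < T₁ →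
      (G : ℝ) / 8 ≤ |tv z i - ev ci (yv z)| := fun z h1 h2 h3 h4 => by
    rcases h.inner_side hL hK with hs | hs
    · have := hs _ h1 h2
      have := evA _ h1 h2
      rw [abs_of_pos (by linarith)]
      linarith
    · have := hs _ h1 h2
      have := evBmin _ h1 h2
      rw [abs_of_neg (by linarith)]
      linarith
  have hbox_j : ∀ z : Fin (0 + 1 + 2) → ℝ, (l : ℝ) < yv z → yv z < u → (Tc : ℝ) < tv z i → tv z i < tv z j →
      tv z j < T₁ → (G : ℝ) / 8 ≤ |tv z j - ev cj (yv z)| := fun z h1 h2 h3 h4 h5 => by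
    rcases h.outer_side hL hK with hs | hs
    · have := hs _ h1 h2
      have := evA _ h1 h2
      rw [abs_of_pos (by linarith)]
      linarith
    · have := hs _ h1 h2
      have := evBmin _ h1 h2
      rw [abs_of_neg (by linarith)]
      linarith
  -- the box converges
  obtain ⟨ρ, hρ, hρle⟩ : ∃ ρ : ℝ, 0 < ρ ∧ ∀ y : ℝ, (l : ℝ) < y → y < u → ρ ≤ |y - T.ℓ₂.2| := by
    rcases hr with hr | hr
    · have hr' : (T.ℓ₂.2 : ℝ) < l := by exact_mod_cast hr
      refine ⟨l - T.ℓ₂.2, by linarith, fun y h1 h2 => ?_⟩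
      rw [abs_of_pos (by linarith)]; linarith
    · have hr' : (u : ℝ) < T.ℓ₂.2 := by exact_mod_cast hr
      refine ⟨T.ℓ₂.2 - u, by linarith, fun y h1 h2 => ?_⟩
      rw [abs_of_neg (by linarith)]; linarith
  have hWW : IntegrableOn (glitB T p a)
      (gDom 0 2 2 ![RebaseZero.mk 1 (-l), RebaseZero.mk (-1) u] (nlo i (RebaseZero.mk 0 Tc)) (nhi j (RebaseZero.mk 0 T₁))) := by
    refine integrableOn_of_abs_le (isSemialgebraic_gDom _ _ _ _) (isBounded_nDom_Ioo hij l u _ _)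
      (isSemialgebraicFunOn_glit (isSemialgebraic_gDom _ _ _ _) _ _ _ _ _ _ _ _)
      (|Kc T p| / (ρ * (G / 8) * (G / 8))) fun z hz => ?_
    rw [mem_nDom_Ioo hij, ev_mk_zero, ev_mk_zero] at hz
    obtain ⟨⟨h1, h2⟩, h3, h4, h5⟩ := hz
    exact abs_glitB_le hL p z hρ (by positivity) (by positivity) (hρle _ h1 h2) (hbox_i z h1 h2 h3 (h4.trans h5))
      (hbox_j z h1 h2 h3 h4 h5)
  -- the format equations of the pieces
  have fT : ∀ c : ℚ, (RebaseZero.mk 0 c).1 (Fin.last 0) = ci.1 (Fin.last 0) := fun c => by rw [mk_fst, hL.ci0]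
  have fS : S₁.1 (Fin.last 0) = cj.1 (Fin.last 0) := by rw [hS₁, mk_fst]
  -- the three dissections
  refine h.good_cut hadm (RebaseZero.mk 0 T₁) hAT hTB (fun s₁ h₁ => ?_) fun s₃ h₃ => h₃.good_par hP (Or.inl (fT T₁))
  refine h₁.good_cut hadm S₁ hAS hST (fun s₁₁ h₁₁ => h₁₁.good_par hP (Or.inr fS)) fun s₂ h₂ => ?_
  exact h₂.good_sub hadm (RebaseZero.mk 0 Tc) hTcS hWW (fun W hW' => hW'.good_par hP (Or.inl (fT Tc)))
    fun r₁ hr₁ => hr₁.good_par hP (Or.inl (fT Tc))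

end RebaseE1

/-- **Registered brick `rebaseSimpleZero_E1cell`** (part `rebaseSimpleZero_HDiff1_of_HPar1` of
`stub_rebaseSimpleZeroTwo`, line `janus-bands`): one grid cell of the box-Janus reduction of the
interval normal form `HDiff₁` to its letter-parallel sub-case `HPar1`. A datum of `HDiff₁`
(`RebaseE1.IsDN`) with non-zero base constant over a short interval away from the base pole on
which the band is thick (`max A + G ≤ min B`, `(|A'| + |B'| + |λ| + 1)(u − l) ≤ G/8`) is congruent
modulo `KZ.relations` to the subgroup generated by `GG 0 2 2`, given `HPar1`
(`RebaseE1.IsDN.good_thin`: two interior cuts and one sub-section Janus with a bounded box).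
[Kontsevich–Zagier 2001, §1.2, rules (1a), (2)] -/
theorem rebaseSimpleZero_E1cell (i j : Fin 2) (s : KZ.IntegralRep (0 + 1 + 2)) (l u : ℚ) (A B ci cj : (Fin (0 + 1) → ℚ) × ℚ) (T : RebaseZero.BData) (p : MvPolynomial (Fin 0) ℚ) (a : Fin 2 → Option ((Fin (0 + 1) → ℚ) × ℚ)) (h : RebaseE1.IsDN s l u A B T p a i j) (hL : RebaseE1.LData T a i j ci cj) (hP : RebaseE1.HParS T p a i j ci cj) (hK : RebaseDiff.Kc T p ≠ 0) (G : ℚ) (hG : 0 < G) (hgap : max (RebaseE1.evq A l) (RebaseE1.evq A u) + G ≤ min (RebaseE1.evq B l) (RebaseE1.evq B u)) (hthin : (|A.1 (Fin.last 0)| + |B.1 (Fin.last 0)| + |cj.1 (Fin.last 0)| + 1) * (u - l) ≤ G / 8) (hr : T.ℓ₂.2 < l ∨ u < T.ℓ₂.2) : RebaseZero.Good 2 (KZ.of s) :=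
  h.good_thin hL hP hK G hG hgap hthin hr

end Summit.KontsevichZagierPeriods.ArrangementNormalForm.JanusBands
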